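import Literature.NumberTheory.ComplexMultiplication.FaltingsTateOfPrimitiveCMProducts
import Summits.HodgeConjecture.HodgeConjecture.Theorems.HCCMUnconditionalShimuraThm18_6Holds
import HarnessLib

/-!
# T5 (N6) — [Fal83 §5 Kor. 1] for finite products of CM abelian varieties of PRIMITIVE types, UNCONDITIONALLY

Cell hodgecm-mathlib, fan A, binder hLiu418 (item stmt-HodgeConjecture-24832), sub-skeleton
`Cruxes/HLiu418/Lines/faltings_isogeny.lean` (row VI-1 = the floor binder
`hFal : ∀ {K} [Field K] (A B : AbelianVariety K) ℓ [Fact ℓ.Prime], faltings_tate_bijective A B ℓ`; T5 ledger row (N6),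
A-plan1 g7/g8).  The Literature heads of `Literature.NumberTheory.ComplexMultiplication.FaltingsTateOfPrimitiveCMProducts`
prove, granted the named fact `shimura1998_thm18_6` ([Shimura 1998, Thm. 18.6]), that for finitely many structures
`(A_i, ι_i)` of PRIMITIVE CM types `(K_i, Φ_i)` over one number field `k ⊆ ℂ` (any dimensions) with pairwise
non-isomorphic CM fields: (i) for every prime `ℓ` ONE `σ₀ ∈ Γ_k` acts on every `T_ℓ A_i` as `T_ℓ(ι_i π_i)` with
`ℚ(π_i) = K_i` ([Shimura 1998, §13.2 Thm. 2, proof], at one completely split prime), hence (ii) the Tate map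
`ℤ_ℓ ⊗ Hom_k(A, B) → Hom_{Γ_k}(T_ℓ A, T_ℓ B)` is bijective for every `A ~ ⨁_s A_{c(s)}`, `B ~ ⨁_t A_{d(t)}`; that fact is a
THEOREM of the tree Summits-side (`Theorems.shimura1998_thm18_6_holds`, row II-1), so here the VI-1 TEXT ITSELF is decided
with NO hypothesis on this family — extending ★ `HLiu418FaltingsTateOfPrimitiveCM` (one structure) and ★
`HLiu418FaltingsTateOfCMEllipticProducts` (two elliptic structures) to arbitrary finite products.
Witness rung («distance ledger»); no floor change, books 0.

HC_CM is proved only modulo the printed citations of the floor until rung 0 closes; this file moves no floor binder.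
-/

-- mandated namespace `Summit.HodgeConjecture.HodgeConjecture.Theorems` trips `linter.dupNamespace` (single-problem
-- summit); off as in `HCCMUnconditionalShimuraThm18_6Holds.lean`.
set_option linter.dupNamespace false

open CategoryTheory CategoryTheory.Limits NumberField
open scoped NumberField IntermediateField

namespace Summit.HodgeConjecture.HodgeConjecture.Theorems

open Literature.AlgebraicGeometry.Motives
open Literature.NumberTheory.ComplexMultiplication

/-- **ONE common scalar Frobenius for finitely many structures of PRIMITIVE CM type, unconditionally**: for
`(A_i, ι_i)` of CM types `(K_i, Φ_i)` over a number field `k ⊆ ℂ` (`i` in a finite index type), each `Φ_i` primitive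
(`IsPrimitive (ℂ ≃+* ℂ) Φ_i φ_i`, [Shimura 1998, §8.2 Prop. 26]), and every prime `ℓ`: some `σ₀ ∈ Γ_k` satisfies
`ρ_{A_i,ℓ}(σ₀) = T_ℓ(ι_i π_i)` with `ℚ(π_i) = K_i` for every `i` — the Literature head fed with the tree's theorem
`shimura1998_thm18_6_holds`.
[cite: Shimura1998, §13.2 Theorem 2 (proof), §13.1 Theorem 1 (ii), §8.2 Proposition 26 and §18.6 Theorem 18.6] -/
theorem exists_common_tateRep_eq_of_primitive_CM_family
    {k : Type} [Field k] [NumberField k] [Algebra k ℂ] {ι : Type} [Finite ι]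
    {K : ι → Type} [∀ i, Field (K i)] [∀ i, NumberField (K i)] [∀ i, IsCMField (K i)]
    (Φ : ∀ i, CMType (K i)) (A : ι → AbelianVariety k) (ιA : ∀ i, 𝓞 (K i) →+* End (A i))
    (hA : ∀ i, IsCMTypeRealisationOver (Φ i) (A i) (ιA i)) {φ₀ : ∀ i, K i →+* ℂ}
    (hprim : ∀ i, IsPrimitive (ℂ ≃+* ℂ) (Φ i).1 (φ₀ i)) (ℓ : ℕ) [Fact ℓ.Prime] :
    ∃ σ₀ : Field.absoluteGaloisGroup k, ∀ i, ∃ π : 𝓞 (K i),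
      (A i).tateRep ℓ σ₀ = AbelianVariety.tateModuleMap ℓ (ιA i π : A i ⟶ A i) ∧ ℚ⟮(π : K i)⟯ = ⊤ :=
  exists_common_tateRep_eq_of_isPrimitive_family shimura1998_thm18_6_holds Φ A ιA hA hprim ℓ

/-- **[Faltings 1983, §5 Kor. 1] on the isogeny classes of finite products (with multiplicities) of PRIMITIVE CM
structures with pairwise non-isomorphic CM fields, every dimension, unconditionally**: for index maps `c : S → ι`,
`d : T → ι`, every `A` `k`-isogenous to `⨁_s A_{c s}`, every `B` `k`-isogenous to `⨁_t A_{d t}` and every prime `ℓ`,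
`faltings_tate_bijective A B ℓ`. [cite: Faltings1983Endlichkeit, §5 Korollar 1]
[cite: Shimura1998, §13.2 Theorem 2 and §18.6 Theorem 18.6] -/
theorem faltings_tate_bijective_of_isIsogenous_biproduct_of_primitive_CM_family
    {k : Type} [Field k] [Algebra k ℂ] {ι : Type} [Finite ι]
    {K : ι → Type} [∀ i, Field (K i)] [∀ i, NumberField (K i)] [∀ i, IsCMField (K i)]
    (Φ : ∀ i, CMType (K i)) (A : ι → AbelianVariety k) (ιA : ∀ i, 𝓞 (K i) →+* End (A i))
    (hA : ∀ i, IsCMTypeRealisationOver (Φ i) (A i) (ιA i)) {φ₀ : ∀ i, K i →+* ℂ}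
    (hprim : ∀ i, IsPrimitive (ℂ ≃+* ℂ) (Φ i).1 (φ₀ i)) (hK : ∀ i i', i ≠ i' → IsEmpty (K i ≃ₐ[ℚ] K i'))
    {S T : Type} [Fintype S] [Fintype T] (c : S → ι) (d : T → ι) {A' B' : AbelianVariety k}
    (hA' : AbelianVariety.IsIsogenous (⨁ fun s => A (c s)) A')
    (hB' : AbelianVariety.IsIsogenous (⨁ fun t => A (d t)) B') (ℓ : ℕ) [Fact ℓ.Prime] :
    faltings_tate_bijective A' B' ℓ := by
  intro hk
  exact faltings_tate_bijective_of_isIsogenous_biproduct_of_isPrimitive_family shimura1998_thm18_6_holds Φ A ιA hA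
    hprim hK ℓ c d hA' hB'

/-- **[Faltings 1983, §5 Kor. 1] on the isogeny classes of finite products of SIMPLE CM abelian varieties with
pairwise non-isomorphic CM fields, every dimension, unconditionally** (`A_i ⊗ ℂ` simple ⟺ `Φ_i` primitive,
[Shimura 1998, §8.2 Prop. 26]). [cite: Faltings1983Endlichkeit, §5 Korollar 1]
[cite: Shimura1998, §8.2 Proposition 26, §13.2 Theorem 2 and §18.6 Theorem 18.6] -/
theorem faltings_tate_bijective_of_isIsogenous_biproduct_of_simple_CM_family
    {k : Type} [Field k] [Algebra k ℂ] {ι : Type} [Finite ι]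
    {K : ι → Type} [∀ i, Field (K i)] [∀ i, NumberField (K i)] [∀ i, IsCMField (K i)]
    (Φ : ∀ i, CMType (K i)) (A : ι → AbelianVariety k) (ιA : ∀ i, 𝓞 (K i) →+* End (A i))
    (hA : ∀ i, IsCMTypeRealisationOver (Φ i) (A i) (ιA i)) (hS : ∀ i, ((A i).baseChange ℂ).IsSimple)
    (hK : ∀ i i', i ≠ i' → IsEmpty (K i ≃ₐ[ℚ] K i'))
    {S T : Type} [Fintype S] [Fintype T] (c : S → ι) (d : T → ι) {A' B' : AbelianVariety k}
    (hA' : AbelianVariety.IsIsogenous (⨁ fun s => A (c s)) A')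
    (hB' : AbelianVariety.IsIsogenous (⨁ fun t => A (d t)) B') (ℓ : ℕ) [Fact ℓ.Prime] :
    faltings_tate_bijective A' B' ℓ := by
  intro hk
  exact faltings_tate_bijective_of_isIsogenous_biproduct_of_isSimple_family shimura1998_thm18_6_holds Φ A ιA hA
    hS hK ℓ c d hA' hB'

end Summit.HodgeConjecture.HodgeConjecture.Theorems
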